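import Summits.Ventures.CertifiedQuantumChemistry.Rows.HubbardHalfFilledHeisenbergSpinLimit
import Summits.Ventures.CertifiedQuantumChemistry.Rows.HeisenbergRingL8GroundEnergy
import Summits.Ventures.CertifiedQuantumChemistry.Rows.HeisenbergRingL10GroundEnergy
import HarnessLib

/-!
# Ventures/CertifiedQuantumChemistry — Rows/HubbardRingL8L10StrongCouplingLimit.lean: the strong-coupling constants of
# the half-filled Hubbard 8-ring and 10-ring, `lim U·E₀(8;U) = −μ₈`, `lim U·E₀(10;U) = −μ₁₀` (T-K0-8, T-K0-10)

HONEST FRAMING (verbatim): certified bounds for a stated model Hamiltonian in a stated basis; not a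
claim about the real molecule beyond that model.

Seat ref/typer (`pub-qchem-typer`, gen 21). THEOREMS ONLY (no `def`, no claim node, no row, no certificate),
zero compute, standard axioms; scores nothing, moves no `CERTIFIED.md` byte. The `L = 8` and `L = 10` members of
the family T-K0-4 (`Rows/HubbardRingStrongCouplingLimit.lean`: `U·E₀(4;U) → −12`), T-K0-6
(`Rows/HubbardRingL6StrongCouplingLimit.lean`: `U·E₀(6;U) → −2(5 + √13)`): by
`Rows/HubbardHalfFilledHeisenbergSpinLimit.lean` ((S), every even `L`:
`U · Model.energy (hubbardRingTV L 1 U) n n → 4·E₀(heisenbergHamiltonian 1 (ringGraph L) 1) − L`) and the exact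
ground-state energies of `Rows/HeisenbergRingL8GroundEnergy.lean` (`E₀ = 2 − μ₈/4`) and
`Rows/HeisenbergRingL10GroundEnergy.lean` (`E₀ = 5/2 − μ₁₀/4`), the sector-`(n,n)` ground-state energies of the
TV-H literal rings (`t = 1`, `U ∈ ℚ`) satisfy, along `U → ∞` in `ℚ`,

  `U · E₀(8;U)  → −μ₈`,  `μ₈³ − 40μ₈² + 464μ₈ − 1600 = 0`,  `μ₈ ∈ [22.6043736356, 22.6043736358]`  (`= 4 h(8)`),
  `U · E₀(10;U) → −μ₁₀`, `μ₁₀⁶ − 84μ₁₀⁵ + 2736μ₁₀⁴ − 43712μ₁₀³ + 352000μ₁₀² − 1276928μ₁₀ + 1372160 = 0`,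
                        `μ₁₀ ∈ [28.0617854179, 28.0617854181]`  (`= 4 h(10)`)

(HOME/STRUCTURE.md §2.2.3: `lim U·E₀(L;U) = −4 h(L)`; the E₀-side constants of the strong-coupling conjecture S-U
(`Rows/ConjectureSU2.lean`) at `L = 8, 10` are thereby KERNEL theorems with explicitly bracketed algebraic
constants — no radical closed forms: the minimal polynomials are an irreducible cubic with three real roots and an
irreducible sextic).

Typer `pub-qchem-typer` (gen 21), 0 core-h.
-/

noncomputable section

namespace Summit.Ventures.CertifiedQuantumChemistry

open Filter Topology
open Literature.MathematicalPhysics.QuantumLattice Literature.MathematicalPhysics.QuantumChemistry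
open Summit.Ventures.CertifiedQuantumChemistry.Hamiltonians

/-! ## L = 8 -/

/-- **T-K0-8.** For the root `μ ∈ [22.6, 22.61]` of `x³ − 40x² + 464x − 1600`:
`U · E_(4,4)(hubbardRingTV 8 1 U) → −μ` as `U → ∞` along `ℚ`. -/
theorem tendsto_mul_energy_hubbardRingTV_eight_of_root {μ : ℝ} (hμ : μ ^ 3 - 40 * μ ^ 2 + 464 * μ - 1600 = 0)
    (h1 : 22.6 ≤ μ) (h2 : μ ≤ 22.61) :
    Tendsto (fun U : ℚ => (U : ℝ) * (hubbardRingTV 8 1 U).energy 4 4) atTop (𝓝 (-μ)) := by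
  have h := tendsto_mul_energy_hubbardRingTV_halfFilled_groundEnergy_sub (L := 8) (n := 4) rfl (by norm_num)
  rw [HeisenbergRing8.groundEnergy_eq_of_root hμ h1 h2] at h
  convert h using 2
  push_cast
  ring

/-- **T-K0-8, with the bracket.** There is `μ ∈ [22.6043736356, 22.6043736358]` with `μ³ − 40μ² + 464μ − 1600 = 0`
and `U · E_(4,4)(hubbardRingTV 8 1 U) → −μ` (`U → ∞` along `ℚ`); i.e. `lim U·E₀(8;U) = −4 h(8)`,
`4 h(8) = μ = 22.6043736357…`. -/
theorem tendsto_mul_energy_hubbardRingTV_eight :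
    ∃ μ : ℝ, μ ∈ Set.Icc (226043736356 / 10 ^ 10 : ℝ) (226043736358 / 10 ^ 10) ∧
      μ ^ 3 - 40 * μ ^ 2 + 464 * μ - 1600 = 0 ∧
      Tendsto (fun U : ℚ => (U : ℝ) * (hubbardRingTV 8 1 U).energy 4 4) atTop (𝓝 (-μ)) := by
  obtain ⟨μ, hμ, hp⟩ := HeisenbergRing8.exists_root
  exact ⟨μ, hμ, hp, tendsto_mul_energy_hubbardRingTV_eight_of_root hp (by linarith [hμ.1]) (by linarith [hμ.2])⟩

/-- The same limit in the `S_z`-sector (`minEnergyOn (szSector 8 0)`) spelling of T-K0-4. -/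
theorem tendsto_mul_minEnergyOn_szSector_hubbardRingTV_eight_of_root {μ : ℝ}
    (hμ : μ ^ 3 - 40 * μ ^ 2 + 464 * μ - 1600 = 0) (h1 : 22.6 ≤ μ) (h2 : μ ≤ 22.61) :
    Tendsto (fun U : ℚ => (U : ℝ) * ((hubbardRingTV 8 1 U).hamiltonian.minEnergyOn (szSector 8 0))) atTop
      (𝓝 (-μ)) := by
  refine (tendsto_mul_energy_hubbardRingTV_eight_of_root hμ h1 h2).congr fun U => ?_
  rw [Model.energy, sectorGroundEnergy_def, sub_self, zero_div]

/-! ## L = 10 -/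

/-- **T-K0-10.** For the root `μ ∈ [28.0617854179, 28.0617854181]` of
`x⁶ − 84x⁵ + 2736x⁴ − 43712x³ + 352000x² − 1276928x + 1372160`:
`U · E_(5,5)(hubbardRingTV 10 1 U) → −μ` as `U → ∞` along `ℚ`. -/
theorem tendsto_mul_energy_hubbardRingTV_ten_of_root {μ : ℝ}
    (hμ : μ ^ 6 - 84 * μ ^ 5 + 2736 * μ ^ 4 - 43712 * μ ^ 3 + 352000 * μ ^ 2 - 1276928 * μ + 1372160 = 0)
    (h1 : (280617854179 / 10 ^ 10 : ℝ) ≤ μ) (h2 : μ ≤ 280617854181 / 10 ^ 10) :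
    Tendsto (fun U : ℚ => (U : ℝ) * (hubbardRingTV 10 1 U).energy 5 5) atTop (𝓝 (-μ)) := by
  have h := tendsto_mul_energy_hubbardRingTV_halfFilled_groundEnergy_sub (L := 10) (n := 5) rfl (by norm_num)
  rw [HeisenbergRing10.groundEnergy_eq_of_root hμ h1 h2] at h
  convert h using 2
  push_cast
  ring

/-- **T-K0-10, with the bracket.** There is `μ ∈ [28.0617854179, 28.0617854181]` with
`μ⁶ − 84μ⁵ + 2736μ⁴ − 43712μ³ + 352000μ² − 1276928μ + 1372160 = 0` and
`U · E_(5,5)(hubbardRingTV 10 1 U) → −μ` (`U → ∞` along `ℚ`); i.e. `lim U·E₀(10;U) = −4 h(10)`,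
`4 h(10) = μ = 28.0617854179…`. -/
theorem tendsto_mul_energy_hubbardRingTV_ten :
    ∃ μ : ℝ, μ ∈ Set.Icc (280617854179 / 10 ^ 10 : ℝ) (280617854181 / 10 ^ 10) ∧
      μ ^ 6 - 84 * μ ^ 5 + 2736 * μ ^ 4 - 43712 * μ ^ 3 + 352000 * μ ^ 2 - 1276928 * μ + 1372160 = 0 ∧
      Tendsto (fun U : ℚ => (U : ℝ) * (hubbardRingTV 10 1 U).energy 5 5) atTop (𝓝 (-μ)) := by
  obtain ⟨μ, hμ, hp⟩ := HeisenbergRing10.exists_root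
  exact ⟨μ, hμ, hp, tendsto_mul_energy_hubbardRingTV_ten_of_root hp hμ.1 hμ.2⟩

/-- The same limit in the `S_z`-sector (`minEnergyOn (szSector 10 0)`) spelling. -/
theorem tendsto_mul_minEnergyOn_szSector_hubbardRingTV_ten_of_root {μ : ℝ}
    (hμ : μ ^ 6 - 84 * μ ^ 5 + 2736 * μ ^ 4 - 43712 * μ ^ 3 + 352000 * μ ^ 2 - 1276928 * μ + 1372160 = 0)
    (h1 : (280617854179 / 10 ^ 10 : ℝ) ≤ μ) (h2 : μ ≤ 280617854181 / 10 ^ 10) :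
    Tendsto (fun U : ℚ => (U : ℝ) * ((hubbardRingTV 10 1 U).hamiltonian.minEnergyOn (szSector 10 0))) atTop
      (𝓝 (-μ)) := by
  refine (tendsto_mul_energy_hubbardRingTV_ten_of_root hμ h1 h2).congr fun U => ?_
  rw [Model.energy, sectorGroundEnergy_def, sub_self, zero_div]

end Summit.Ventures.CertifiedQuantumChemistry

end
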